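import Mathlib
import HarnessLib
import Summits.HubbardSuperconductivity.HubbardSuperconductivity.Theorems.BalabanIRBirComplexStableXYChainKernel

/-!
# BalabanIR engine `BirComplexStableXY` (stmt-HubbardSuperconductivity-2080): path and trace
formulas for the chain kernels

Support lemmas for crux 2 of route BalabanIR (`--supports stmt-HubbardSuperconductivity-2080`),
abstract part, continued from `BalabanIRBirComplexStableXYChainKernel.lean`.  For a continuous
bounded two-slice kernel `k` on `X = (ι → ℝ)`, a finite measure `μ` and the chain kernels `G n`
(`G 0 = k`, `G (n+1) a b = ∫ G n a c * k c b dμ(c)`):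

* `birChain_integral_path` — the OPEN PATH formula: integrating the bond product
  `k(a,σ₀) k(σ₀,σ₁) ⋯ k(σ_{m-1},b)` over the `m` intermediate slices `σ : Fin m → X` (product
  measure `μ^{⊗ m}`) gives `G m a b` (induction on `m`, peeling the last slice with
  `measurePreserving_piFinSuccAbove` and Fubini);
* `birChain_integral_cyclic` — the CYCLIC TRACE formula: for `m + 1` slices on a temporal circle
  `Fin (m+1)` (bonds `τ → τ+1`, wrapping around) and an observable `f` read on slice `0`,
  `∫ f(σ 0) ∏_τ k(σ_τ, σ_{τ+1}) dμ^{⊗(m+1)} = ∫ f(a) G m a a dμ(a)` — the path-integral form of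
  `Tr (f T^(m+1))`.

Pure bookkeeping (`Fin.cons`/`Fin.snoc`, `Fin.prod_univ_castSucc`) plus Fubini on finite measures;
no operator theory.
-/

namespace Summit.HubbardSuperconductivity.HubbardSuperconductivity.Theorems

open scoped BigOperators ComplexConjugate
open MeasureTheory

section PathBookkeeping

variable {X : Type*}

/-- `cons a (snoc g b)` restricted to the first `n+1` entries is `cons a g`. -/
theorem birPath_cons_snoc_castSucc {n : ℕ} (a b : X) (g : Fin n → X) (j : Fin (n + 1)) :
    Fin.cons (α := fun _ => X) a (Fin.snoc (α := fun _ => X) g b) j.castSucc =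
      Fin.cons (α := fun _ => X) a g j := by
  rw [Fin.cons_snoc_eq_snoc_cons, Fin.snoc_castSucc]

/-- The last entry of `cons a (snoc g b)` is `b`. -/
theorem birPath_cons_snoc_last {n : ℕ} (a b : X) (g : Fin n → X) :
    Fin.cons (α := fun _ => X) a (Fin.snoc (α := fun _ => X) g b) (Fin.last (n + 1)) = b := by
  rw [Fin.cons_snoc_eq_snoc_cons, Fin.snoc_last]

/-- Peeling the last bond off an open path `a → τ₀ → ⋯ → τ_{m-1} → x → b`. -/
theorem birPath_prod_snoc (f : X → X → ℂ) {m : ℕ} (a b x : X) (τ : Fin m → X) :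
    ∏ i : Fin (m + 2),
        f (Fin.cons (α := fun _ => X) a
            (Fin.snoc (α := fun _ => X) (Fin.snoc (α := fun _ => X) τ x) b) i.castSucc)
          (Fin.cons (α := fun _ => X) a
            (Fin.snoc (α := fun _ => X) (Fin.snoc (α := fun _ => X) τ x) b) i.succ)
      = (∏ i : Fin (m + 1),
          f (Fin.cons (α := fun _ => X) a (Fin.snoc (α := fun _ => X) τ x) i.castSucc)
            (Fin.cons (α := fun _ => X) a (Fin.snoc (α := fun _ => X) τ x) i.succ)) * f x b := by
  rw [Fin.prod_univ_castSucc]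
  congr 1
  · refine Finset.prod_congr rfl fun i _ => ?_
    rw [Fin.succ_castSucc, birPath_cons_snoc_castSucc a b _ i.castSucc,
      birPath_cons_snoc_castSucc a b _ i.succ]
  · rw [Fin.succ_last, birPath_cons_snoc_castSucc a b _ (Fin.last (m + 1)),
      birPath_cons_snoc_last, Fin.cons_snoc_eq_snoc_cons, Fin.snoc_last]

/-- Closing a cycle: on the temporal circle `Fin (m+1)` with slice `0` equal to `a` and the other
slices `σ`, the cyclic bond product equals the open-path product from `a` back to `a`. -/
theorem birPath_prod_cyclic (f : X → X → ℂ) {m : ℕ} (a : X) (σ : Fin m → X) :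
    ∏ τ : Fin (m + 1), f (Fin.cons (α := fun _ => X) a σ τ) (Fin.cons (α := fun _ => X) a σ (τ + 1))
      = ∏ i : Fin (m + 1),
          f (Fin.cons (α := fun _ => X) a (Fin.snoc (α := fun _ => X) σ a) i.castSucc)
            (Fin.cons (α := fun _ => X) a (Fin.snoc (α := fun _ => X) σ a) i.succ) := by
  refine Finset.prod_congr rfl fun i _ => ?_
  rw [birPath_cons_snoc_castSucc]
  congr 1
  rcases Fin.eq_castSucc_or_eq_last i with ⟨j, rfl⟩ | rfl
  · rw [Fin.coeSucc_eq_succ, Fin.cons_succ, Fin.succ_castSucc, birPath_cons_snoc_castSucc,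
      Fin.cons_succ]
  · rw [Fin.last_add_one, Fin.cons_zero, Fin.succ_last, birPath_cons_snoc_last]

end PathBookkeeping

section Trace

variable {ι : Type*} [Fintype ι] {μ : Measure (ι → ℝ)} [IsFiniteMeasure μ]
  {k : (ι → ℝ) → (ι → ℝ) → ℂ} {G : ℕ → (ι → ℝ) → (ι → ℝ) → ℂ} {R : ℝ}

omit [Fintype ι] in
/-- The open-path bond product is continuous in the intermediate slices and bounded by
`R^(m+1)`. -/
theorem birPath_prod_continuous_bound (hk : Continuous (Function.uncurry k))
    (hR : ∀ a b, ‖k a b‖ ≤ R) (m : ℕ) (a b : ι → ℝ) :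
    Continuous (fun σ : Fin m → ι → ℝ => ∏ i : Fin (m + 1),
        k (Fin.cons (α := fun _ => ι → ℝ) a (Fin.snoc (α := fun _ => ι → ℝ) σ b) i.castSucc)
          (Fin.cons (α := fun _ => ι → ℝ) a (Fin.snoc (α := fun _ => ι → ℝ) σ b) i.succ)) ∧
    ∀ σ : Fin m → ι → ℝ, ‖∏ i : Fin (m + 1),
        k (Fin.cons (α := fun _ => ι → ℝ) a (Fin.snoc (α := fun _ => ι → ℝ) σ b) i.castSucc)
          (Fin.cons (α := fun _ => ι → ℝ) a (Fin.snoc (α := fun _ => ι → ℝ) σ b) i.succ)‖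
      ≤ R ^ (m + 1) := by
  have hext : Continuous (fun σ : Fin m → ι → ℝ =>
      (Fin.cons (α := fun _ => ι → ℝ) a (Fin.snoc (α := fun _ => ι → ℝ) σ b))) :=
    Continuous.finCons continuous_const (Continuous.finSnoc continuous_id continuous_const)
  refine ⟨?_, fun σ => ?_⟩
  · refine continuous_finsetProd _ fun i _ => ?_
    exact hk.comp (((continuous_apply i.castSucc).comp hext).prodMk
      ((continuous_apply i.succ).comp hext))
  · refine (Finset.norm_prod_le _ _).trans ?_
    calc ∏ i : Fin (m + 1), ‖k (Fin.cons (α := fun _ => ι → ℝ) a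
              (Fin.snoc (α := fun _ => ι → ℝ) σ b) i.castSucc)
            (Fin.cons (α := fun _ => ι → ℝ) a (Fin.snoc (α := fun _ => ι → ℝ) σ b) i.succ)‖
        ≤ ∏ _i : Fin (m + 1), R :=
          Finset.prod_le_prod (fun i _ => norm_nonneg _) (fun i _ => hR _ _)
      _ = R ^ (m + 1) := by simp

/-- **Open-path formula.** Integrating the bond product `k(a,σ₀) k(σ₀,σ₁) ⋯ k(σ_{m-1},b)` over
the `m` intermediate slices gives the chain kernel `G m a b`. -/
theorem birChain_integral_path (hk : Continuous (Function.uncurry k)) (hR : ∀ a b, ‖k a b‖ ≤ R)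
    (hG0 : ∀ a b, G 0 a b = k a b) (hGs : ∀ n a b, G (n + 1) a b = ∫ c, G n a c * k c b ∂μ) :
    ∀ (m : ℕ) (a b : ι → ℝ),
      ∫ σ : Fin m → ι → ℝ, ∏ i : Fin (m + 1),
          k (Fin.cons (α := fun _ => ι → ℝ) a (Fin.snoc (α := fun _ => ι → ℝ) σ b) i.castSucc)
            (Fin.cons (α := fun _ => ι → ℝ) a (Fin.snoc (α := fun _ => ι → ℝ) σ b) i.succ)
        ∂(Measure.pi fun _ => μ) = G m a b := by
  intro m
  induction m with
  | zero =>
    intro a b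
    rw [Measure.pi_of_empty (fun _ : Fin 0 => μ), integral_dirac, Fin.prod_univ_one, hG0]
    rfl
  | succ m ih =>
    intro a b
    set e := MeasurableEquiv.piFinSuccAbove (fun _ : Fin (m + 1) => ι → ℝ) (Fin.last m) with he_def
    have hmp : MeasurePreserving e (Measure.pi fun _ => μ) (μ.prod (Measure.pi fun _ => μ)) :=
      measurePreserving_piFinSuccAbove (fun _ => μ) (Fin.last m)
    have he : ∀ (x : ι → ℝ) (τ : Fin m → ι → ℝ),
        e.symm (x, τ) = Fin.snoc (α := fun _ => ι → ℝ) τ x := by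
      intro x τ
      rw [he_def, MeasurableEquiv.piFinSuccAbove_symm_apply]
      exact Fin.insertNth_last' x τ
    set P : (Fin (m + 1) → ι → ℝ) → ℂ := fun σ => ∏ i : Fin (m + 1 + 1),
        k (Fin.cons (α := fun _ => ι → ℝ) a (Fin.snoc (α := fun _ => ι → ℝ) σ b) i.castSucc)
          (Fin.cons (α := fun _ => ι → ℝ) a (Fin.snoc (α := fun _ => ι → ℝ) σ b) i.succ) with hP
    obtain ⟨hPc, hPb⟩ := birPath_prod_continuous_bound hk hR (m + 1) a b
    have hPint : Integrable P (Measure.pi fun _ => μ) :=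
      Integrable.of_bound hPc.aestronglyMeasurable _ (Filter.Eventually.of_forall hPb)
    have hint : Integrable (fun p => P (e.symm p)) (μ.prod (Measure.pi fun _ => μ)) :=
      (hmp.symm.integrable_comp_emb e.symm.measurableEmbedding).mpr hPint
    calc ∫ σ, P σ ∂(Measure.pi fun _ => μ)
        = ∫ p, P (e.symm p) ∂(μ.prod (Measure.pi fun _ => μ)) := (hmp.symm.integral_comp' P).symm
      _ = ∫ x, ∫ τ, P (e.symm (x, τ)) ∂(Measure.pi fun _ => μ) ∂μ := integral_prod _ hint
      _ = ∫ x, ∫ τ : Fin m → ι → ℝ, (∏ i : Fin (m + 1),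
            k (Fin.cons (α := fun _ => ι → ℝ) a (Fin.snoc (α := fun _ => ι → ℝ) τ x) i.castSucc)
              (Fin.cons (α := fun _ => ι → ℝ) a (Fin.snoc (α := fun _ => ι → ℝ) τ x) i.succ))
            * k x b ∂(Measure.pi fun _ => μ) ∂μ := by
          refine integral_congr_ae (Filter.Eventually.of_forall fun x => ?_)
          refine integral_congr_ae (Filter.Eventually.of_forall fun τ => ?_)
          show P (e.symm (x, τ)) = _
          rw [he, hP]
          exact birPath_prod_snoc k a b x τ
      _ = ∫ x, G m a x * k x b ∂μ := by
          refine integral_congr_ae (Filter.Eventually.of_forall fun x => ?_)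
          show ∫ τ : Fin m → ι → ℝ, _ * k x b ∂(Measure.pi fun _ => μ) = G m a x * k x b
          rw [integral_mul_const, ih a x]
      _ = G (m + 1) a b := (hGs m a b).symm

omit [Fintype ι] in
/-- The cyclic integrand `f(σ 0) ∏_τ k(σ_τ, σ_{τ+1})` is continuous and bounded. -/
theorem birCyclic_integrand_continuous_bound (hk : Continuous (Function.uncurry k))
    (hR : ∀ a b, ‖k a b‖ ≤ R) {f : (ι → ℝ) → ℂ} (hf : Continuous f) {Cf : ℝ}
    (hCf : ∀ a, ‖f a‖ ≤ Cf) (m : ℕ) :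
    Continuous (fun σ : Fin (m + 1) → ι → ℝ =>
        f (σ 0) * ∏ τ : Fin (m + 1), k (σ τ) (σ (τ + 1))) ∧
    ∀ σ : Fin (m + 1) → ι → ℝ, ‖f (σ 0) * ∏ τ : Fin (m + 1), k (σ τ) (σ (τ + 1))‖
      ≤ Cf * R ^ (m + 1) := by
  refine ⟨?_, fun σ => ?_⟩
  · refine (hf.comp (continuous_apply 0)).mul (continuous_finsetProd _ fun τ _ => ?_)
    exact hk.comp (f := fun σ : Fin (m + 1) → ι → ℝ => (σ τ, σ (τ + 1)))
      ((continuous_apply τ).prodMk (continuous_apply (τ + 1)))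
  · rw [norm_mul]
    refine mul_le_mul (hCf _) ((Finset.norm_prod_le _ _).trans ?_) (norm_nonneg _)
      ((norm_nonneg _).trans (hCf 0))
    calc ∏ τ : Fin (m + 1), ‖k (σ τ) (σ (τ + 1))‖ ≤ ∏ _τ : Fin (m + 1), R :=
          Finset.prod_le_prod (fun i _ => norm_nonneg _) (fun i _ => hR _ _)
      _ = R ^ (m + 1) := by simp

/-- The cyclic integrand is integrable for the product of finite measures (used by the
companion file). -/
theorem birCyclic_integrand_integrable (hk : Continuous (Function.uncurry k))
    (hR : ∀ a b, ‖k a b‖ ≤ R) {f : (ι → ℝ) → ℂ} (hf : Continuous f) {Cf : ℝ}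
    (hCf : ∀ a, ‖f a‖ ≤ Cf) (m : ℕ) :
    Integrable (fun σ : Fin (m + 1) → ι → ℝ =>
        f (σ 0) * ∏ τ : Fin (m + 1), k (σ τ) (σ (τ + 1))) (Measure.pi fun _ => μ) := by
  obtain ⟨hc, hb⟩ := birCyclic_integrand_continuous_bound hk hR hf hCf m
  exact Integrable.of_bound hc.aestronglyMeasurable _ (Filter.Eventually.of_forall hb)

/-- **Cyclic trace formula.** On the temporal circle `Fin (m+1)` (bonds `τ → τ + 1`, wrapping
around), for an observable `f` read on slice `0`:
`∫ f(σ 0) ∏_τ k(σ_τ, σ_{τ+1}) dμ^{⊗(m+1)}(σ) = ∫ f(a) G m a a dμ(a)` — the path-integral form of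
`Tr (f · T^(m+1))`. -/
theorem birChain_integral_cyclic (hk : Continuous (Function.uncurry k)) (hR : ∀ a b, ‖k a b‖ ≤ R)
    (hG0 : ∀ a b, G 0 a b = k a b) (hGs : ∀ n a b, G (n + 1) a b = ∫ c, G n a c * k c b ∂μ)
    {f : (ι → ℝ) → ℂ} (hf : Continuous f) {Cf : ℝ} (hCf : ∀ a, ‖f a‖ ≤ Cf) (m : ℕ) :
    ∫ σ : Fin (m + 1) → ι → ℝ, f (σ 0) * ∏ τ : Fin (m + 1), k (σ τ) (σ (τ + 1))
        ∂(Measure.pi fun _ => μ) = ∫ a, f a * G m a a ∂μ := by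
  set e := MeasurableEquiv.piFinSuccAbove (fun _ : Fin (m + 1) => ι → ℝ) 0 with he_def
  have hmp : MeasurePreserving e (Measure.pi fun _ => μ) (μ.prod (Measure.pi fun _ => μ)) :=
    measurePreserving_piFinSuccAbove (fun _ => μ) 0
  have he : ∀ (a : ι → ℝ) (σ : Fin m → ι → ℝ),
      e.symm (a, σ) = Fin.cons (α := fun _ => ι → ℝ) a σ := by
    intro a σ
    rw [he_def, MeasurableEquiv.piFinSuccAbove_symm_apply]
    exact Fin.insertNth_zero' a σ
  set Q : (Fin (m + 1) → ι → ℝ) → ℂ := fun σ =>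
    f (σ 0) * ∏ τ : Fin (m + 1), k (σ τ) (σ (τ + 1)) with hQ
  have hQint : Integrable Q (Measure.pi fun _ => μ) := birCyclic_integrand_integrable hk hR hf hCf m
  have hint : Integrable (fun p => Q (e.symm p)) (μ.prod (Measure.pi fun _ => μ)) :=
    (hmp.symm.integrable_comp_emb e.symm.measurableEmbedding).mpr hQint
  calc ∫ σ, Q σ ∂(Measure.pi fun _ => μ)
      = ∫ p, Q (e.symm p) ∂(μ.prod (Measure.pi fun _ => μ)) := (hmp.symm.integral_comp' Q).symm
    _ = ∫ a, ∫ σ, Q (e.symm (a, σ)) ∂(Measure.pi fun _ => μ) ∂μ := integral_prod _ hint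
    _ = ∫ a, ∫ σ : Fin m → ι → ℝ, f a * ∏ i : Fin (m + 1),
          k (Fin.cons (α := fun _ => ι → ℝ) a (Fin.snoc (α := fun _ => ι → ℝ) σ a) i.castSucc)
            (Fin.cons (α := fun _ => ι → ℝ) a (Fin.snoc (α := fun _ => ι → ℝ) σ a) i.succ)
          ∂(Measure.pi fun _ => μ) ∂μ := by
        refine integral_congr_ae (Filter.Eventually.of_forall fun a => ?_)
        refine integral_congr_ae (Filter.Eventually.of_forall fun σ => ?_)
        show Q (e.symm (a, σ)) = _
        rw [he, hQ]
        show f (Fin.cons (α := fun _ => ι → ℝ) a σ 0) * _ = _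
        rw [Fin.cons_zero, birPath_prod_cyclic k a σ]
    _ = ∫ a, f a * G m a a ∂μ := by
        refine integral_congr_ae (Filter.Eventually.of_forall fun a => ?_)
        show ∫ σ : Fin m → ι → ℝ, f a * _ ∂(Measure.pi fun _ => μ) = f a * G m a a
        rw [integral_const_mul, birChain_integral_path hk hR hG0 hGs m a a]

end Trace

end Summit.HubbardSuperconductivity.HubbardSuperconductivity.Theorems
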